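import Mathlib
import HarnessLib
import Summits.NavierStokesRegularity.NavierStokesRegularity.Theorems.LocalSineTubeDoorProfileAlignedWindowRigidityAncient
import Summits.NavierStokesRegularity.NavierStokesRegularity.Theorems.PoloidalWindowDoorLrcModEntireRidgeAssembly
import Summits.NavierStokesRegularity.NavierStokesRegularity.Theorems.PoloidalWindowDoorLrcModEntireRidgeTaylor

/-!
# Item `LrcModEntire` (stmt-NavierStokesRegularity-20428), registry twist_split v7 — the «ridge quasiconvexity» lever AT CLASS LEVEL (memo `Cruxes/LrcModEntire/T2B-g14.md` §9–§10, rung CL-1):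
# for a class profile, along a HOT ARC with a straight tube chart, the ridge coefficient `θ_νz²/κ + θ_zz` is quasiconvex

LEAD of item 20428 ns-poloidal-K2-p3 g14 (`--supports stmt-NavierStokesRegularity-20428 --as helper`).  Feeds the class into the class-free ASSEMBLY
`…RidgeAssembly.quasiconvexOn_ridgeCoeff_of_peakless` (p706175) through (H) `…RidgeTaylor.ridgeExpansion_of_contDiff` (p705942) applied to `f = σ·v₂(−1,·)` on `ℝ³` itself:
the slice is smooth (`analyticOnNhd_slice`), its jets are bounded ((F1), supplied by the caller as `‖D²v(−1,·)‖ ≤ C₂`, `‖D³v(−1,·)‖ ≤ C₃` — `exists_norm_iteratedFDeriv_le_slice_of_hasTypeITimeDecay`),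
hot points are critical (the cells' binder «`∇ₕ`-critical hot set», here the full gradient of `v₂(−1,·)` as in `hT2b`), and the chart cross-sections are the straight segments
`n ↦ γ(s) + n·ν(s)` of a tube chart `e` (port-2 g5's (TC) `…TubeChart`, or a graph chart).

* `quasiconvexOn_ridgeCoeff_of_class` — class clauses (Type-I rate, continuity, Oseen-mild) + Peakless + critical hot set + a hot arc `γ` in `P₀` with unit normals `ν`, a tube chart `e` with
  `P z (e(s,n)) = γ(s) + nν(s) + z·e_z`, cold lateral boundary, uniform transversal non-degeneracy `κ(s) = −σ∂_ν∂_ν v₂(−1,γ(s)) ≥ κ₀ > 0`, and a thin tube `64C₃r ≤ κ₀`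
  ⇒ **`s ↦ α(s)²/κ(s) + β(s)` is `QuasiconvexOn ℝ [a₁,a₂]`**, where `α(s) = σ∂_ν∂_z v₂(−1,γ(s))`, `β(s) = σ∂_z∂_z v₂(−1,γ(s))` (defining equations).

Remaining for `stub_T2b` (memo §10): the (TH) ridge law (`κ`, `β` constant on `H` ⇒ `α²` quasiconvex, `…RidgeSecondOrder.quasiconvexOn_sq_of_ridgeLaw`), the hull step (Q3), the cell (Q4).
WHAT THIS IS NOT: not a claim about Navier–Stokes regularity — a necessary condition on the hot ridge of a hypothetical profile (bears_on LADDER-NS N0, item 20428 / crux 19708; both OPEN,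
⟨27893⟩ OPEN).
-/

noncomputable section

-- the summit and its single sub-problem share the name (CONVENTIONS §1), as in every Theorems file
set_option linter.dupNamespace false

namespace Summit.NavierStokesRegularity.NavierStokesRegularity.Theorems.PoloidalWindowDoorLrcModEntireRidgeClass

open Set Filter Topology Metric Function
open scoped ContDiff
open Literature.Analysis Literature.Analysis.FluidPDE
open Summit.NavierStokesRegularity.NavierStokesRegularity.Theorems.LocalSineTubeDoorProfileAlignedWindowRigidityAncient
open Summit.NavierStokesRegularity.NavierStokesRegularity.Theorems.PoloidalWindowDoorLrcModEntireRidgeAssembly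
open Summit.NavierStokesRegularity.NavierStokesRegularity.Theorems.PoloidalWindowDoorLrcModEntireRidgeTaylor

variable {C : ℝ} {v : ℝ → EuclideanSpace ℝ (Fin 3) → EuclideanSpace ℝ (Fin 3)}

/-! ### Jet bookkeeping for the signed vertical component `f = σ·v₂(−1,·)` -/

/-- A coordinate of an iterated derivative is bounded by the iterated derivative of the field. -/
theorem norm_iteratedFDeriv_coord_le {u : EuclideanSpace ℝ (Fin 3) → EuclideanSpace ℝ (Fin 3)} (hu : ContDiff ℝ ∞ u) (n : ℕ) (i : Fin 3)
    (w : EuclideanSpace ℝ (Fin 3)) : ‖iteratedFDeriv ℝ n (fun y => u y i) w‖ ≤ ‖iteratedFDeriv ℝ n u w‖ := by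
  have h := (EuclideanSpace.proj (𝕜 := ℝ) i).norm_iteratedFDeriv_comp_left (f := u) (x := w) (n := n) (hu.contDiffAt) (by exact_mod_cast le_top)
  have hproj : ‖(EuclideanSpace.proj (𝕜 := ℝ) i : EuclideanSpace ℝ (Fin 3) →L[ℝ] ℝ)‖ ≤ 1 :=
    ContinuousLinearMap.opNorm_le_bound _ zero_le_one fun y => by simpa using PiLp.norm_apply_le y i
  have e : (fun y => u y i) = (EuclideanSpace.proj (𝕜 := ℝ) i) ∘ u := rfl
  rw [e]
  exact h.trans ((mul_le_mul_of_nonneg_right hproj (norm_nonneg _)).trans (by rw [one_mul]))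

/-- The signed coordinate `σ·u₂`, `σ = ±1`, has the same jet norms as `u₂`. -/
theorem norm_iteratedFDeriv_signed_le {u : EuclideanSpace ℝ (Fin 3) → EuclideanSpace ℝ (Fin 3)} (hu : ContDiff ℝ ∞ u) {σ : ℝ} (hσ : σ = 1 ∨ σ = -1)
    (n : ℕ) (w : EuclideanSpace ℝ (Fin 3)) : ‖iteratedFDeriv ℝ n (fun y => σ * u y 2) w‖ ≤ ‖iteratedFDeriv ℝ n u w‖ := by
  rcases hσ with rfl | rfl
  · simpa using norm_iteratedFDeriv_coord_le hu n 2 w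
  · have e : (fun y => (-1 : ℝ) * u y 2) = -fun y => u y 2 := by funext y; simp
    rw [e, iteratedFDeriv_neg, Pi.neg_apply, norm_neg]
    exact norm_iteratedFDeriv_coord_le hu n 2 w

/-- A value of `D²f(y)` is bounded by the jet norm: `|D²f(y)[u,w]| ≤ ‖D²f(y)‖·‖u‖·‖w‖` (`iteratedFDeriv` form). -/
theorem abs_fderiv_fderiv_le {f : EuclideanSpace ℝ (Fin 3) → ℝ} (y u w : EuclideanSpace ℝ (Fin 3)) :
    |fderiv ℝ (fderiv ℝ f) y u w| ≤ ‖iteratedFDeriv ℝ 2 f y‖ * (‖u‖ * ‖w‖) := by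
  have h := (iteratedFDeriv ℝ 2 f y).le_opNorm ![u, w]
  rw [iteratedFDeriv_two_apply, Fin.prod_univ_two] at h
  simpa using h

/-! ### The class-level lever -/

/-- **THE RIDGE COEFFICIENT OF A CLASS PROFILE IS QUASICONVEX ALONG A HOT ARC.**  See the module docstring. -/
theorem quasiconvexOn_ridgeCoeff_of_class
    (hdec : HasTypeITimeDecay C v) (hcont : ContinuousOn (uncurry v) (Iio (0 : ℝ) ×ˢ univ))
    (hmild : ∀ s t : ℝ, s < t → t < 0 → ∀ x, v t x = UnboundedOperators.heatExtension (v s) (t - s) x - oseenDuhamel 1 s v v t x)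
    (hpk : ∀ (s z₀ σ M : ℝ) (K O : Set (EuclideanSpace ℝ (Fin 3))), s < 0 →
      ((σ = 1 ∨ σ = -1) ∧ IsCompact K ∧ K.Nonempty ∧ (∀ y ∈ K, y 2 = z₀ ∧ σ * v s y 2 = M) ∧
        IsOpen O ∧ K ⊆ O ∧ (∀ y ∈ O, y 2 = z₀ → σ * v s y 2 ≤ M) ∧
        (∀ y ∈ O, y 2 = z₀ → σ * v s y 2 = M → y ∈ K)) → False)
    (hcrit : ∀ y ∈ {y : EuclideanSpace ℝ (Fin 3) | y 2 = 0 ∧ v (-1) y 2 = v (-1) 0 2}, fderiv ℝ (fun x => v (-1) x 2) y = 0)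
    {C₂ C₃ : ℝ} (hC₂ : ∀ x, ‖iteratedFDeriv ℝ 2 (v (-1)) x‖ ≤ C₂) (hC₃ : ∀ x, ‖iteratedFDeriv ℝ 3 (v (-1)) x‖ ≤ C₃)
    {σ : ℝ} (hσ : σ = 1 ∨ σ = -1)
    (e : OpenPartialHomeomorph (ℝ × ℝ) (ℝ × ℝ)) {a₁ a₂ r : ℝ} (ha : a₁ ≤ a₂) (hr : 0 < r) (hsrc : Icc a₁ a₂ ×ˢ Icc (-r) r ⊆ e.source)
    {P : ℝ → ℝ × ℝ → EuclideanSpace ℝ (Fin 3)} (hP : ∀ z₀ q, P z₀ q = WithLp.toLp 2 ![q.1, q.2, z₀])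
    {γ ν : ℝ → EuclideanSpace ℝ (Fin 3)}
    (hγν : ∀ s ∈ Icc a₁ a₂, ∀ n z : ℝ, P z (e (s, n)) = γ s + n • ν s + z • EuclideanSpace.single 2 1)
    (hν : ∀ s ∈ Icc a₁ a₂, ‖ν s‖ ≤ 1)
    (hhot : ∀ s ∈ Icc a₁ a₂, γ s 2 = 0 ∧ v (-1) (γ s) 2 = v (-1) 0 2)
    (hlat0 : ∀ a ∈ Icc a₁ a₂, ∀ n : ℝ, (n = r ∨ n = -r) → σ * v (-1) (P 0 (e (a, n))) 2 < σ * v (-1) 0 2)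
    {κ α β : ℝ → ℝ}
    (hκdef : ∀ s ∈ Icc a₁ a₂, κ s = -(fderiv ℝ (fderiv ℝ (fun y => σ * v (-1) y 2)) (γ s) (ν s) (ν s)))
    (hαdef : ∀ s ∈ Icc a₁ a₂, α s = fderiv ℝ (fderiv ℝ (fun y => σ * v (-1) y 2)) (γ s) (ν s) (EuclideanSpace.single 2 1))
    (hβdef : ∀ s ∈ Icc a₁ a₂, β s = fderiv ℝ (fderiv ℝ (fun y => σ * v (-1) y 2)) (γ s) (EuclideanSpace.single 2 1) (EuclideanSpace.single 2 1))
    {κ₀ : ℝ} (hκ₀ : 0 < κ₀) (hκ : ∀ s ∈ Icc a₁ a₂, κ₀ ≤ κ s) (hthin : 64 * C₃ * r ≤ κ₀) :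
    QuasiconvexOn ℝ (Icc a₁ a₂) fun s => α s ^ 2 / κ s + β s := by
  have hneg : (-1 : ℝ) < 0 := by norm_num
  -- the signed slice `f = σ·v₂(−1,·)`: smooth, bounded jets, critical on the hot set
  have hslice : ContDiff ℝ ∞ (v (-1)) := (analyticOnNhd_slice hcont (bdd_of_hasTypeITimeDecay hdec) hmild hneg).contDiff
  set f : EuclideanSpace ℝ (Fin 3) → ℝ := fun y => σ * v (-1) y 2 with hfdef
  have hf : ContDiff ℝ 3 f := by
    have h2 : ContDiff ℝ ∞ (fun y => v (-1) y 2) :=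
      (contDiff_piLp_apply (p := 2) (𝕜 := ℝ) (E := fun _ : Fin 3 => ℝ) (i := (2 : Fin 3))).comp hslice
    exact (contDiff_const.mul h2).of_le (by exact WithTop.coe_le_coe.2 le_top)
  have hfC₃ : ∀ x, ‖iteratedFDeriv ℝ 3 f x‖ ≤ C₃ := fun x => (norm_iteratedFDeriv_signed_le hslice hσ 3 x).trans (hC₃ x)
  have hfC₂ : ∀ x, ‖iteratedFDeriv ℝ 2 f x‖ ≤ C₂ := fun x => (norm_iteratedFDeriv_signed_le hslice hσ 2 x).trans (hC₂ x)
  have hC₃0 : 0 ≤ C₃ := (norm_nonneg _).trans (hC₃ 0)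
  have hC₂0 : 0 ≤ C₂ := (norm_nonneg _).trans (hC₂ 0)
  have hfcrit : ∀ s ∈ Icc a₁ a₂, fderiv ℝ f (γ s) = 0 := by
    intro s hs
    have h0 := hcrit (γ s) (hhot s hs)
    have hd : DifferentiableAt ℝ (fun y => v (-1) y 2) (γ s) :=
      (((contDiff_piLp_apply (p := 2) (𝕜 := ℝ) (E := fun _ : Fin 3 => ℝ) (i := (2 : Fin 3))).comp hslice).differentiable (by simp)) _
    have h1 : HasFDerivAt (fun y => σ • v (-1) y 2) (σ • fderiv ℝ (fun x => v (-1) x 2) (γ s)) (γ s) :=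
      hd.hasFDerivAt.const_smul σ
    rw [h0, smul_zero] at h1
    rw [hfdef, show (fun y => σ * v (-1) y 2) = fun y => σ • (v (-1) y 2) from rfl]
    exact h1.fderiv
  -- the uniform bound on `α`
  have he₂ : ‖(EuclideanSpace.single (2 : Fin 3) (1 : ℝ))‖ = 1 := by simp
  have hαA : ∀ s ∈ Icc a₁ a₂, |α s| ≤ C₂ := by
    intro s hs
    rw [hαdef s hs]
    refine (abs_fderiv_fderiv_le (γ s) (ν s) _).trans ?_
    rw [he₂, mul_one]
    calc ‖iteratedFDeriv ℝ 2 f (γ s)‖ * ‖ν s‖ ≤ C₂ * 1 := mul_le_mul (hfC₂ _) (hν s hs) (norm_nonneg _) hC₂0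
      _ = C₂ := mul_one _
  -- the hot centre
  have hmid0 : ∀ a ∈ Icc a₁ a₂, σ * v (-1) (P 0 (e (a, 0))) 2 = σ * v (-1) 0 2 := by
    intro a ha'
    have h := hγν a ha' 0 0
    rw [zero_smul, zero_smul, add_zero, add_zero] at h
    rw [h, (hhot a ha').2]
  -- the second-order expansion of every cross-section: (H) at the critical point `γ s` in the directions `ν s`, `e_z`
  have hexp : ∀ s ∈ Icc a₁ a₂, ∀ n z : ℝ,
      |σ * v (-1) (P z (e (s, n))) 2 - (σ * v (-1) 0 2 - κ s / 2 * n ^ 2 + α s * n * z + β s / 2 * z ^ 2)| ≤ C₃ * (|n| + |z|) ^ 3 := by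
    intro s hs n z
    have h := ridgeExpansion_of_contDiff hf hfC₃ (hfcrit s hs) (hν s hs) (le_of_eq he₂) (hκdef s hs) (hαdef s hs) (hβdef s hs) n z
    have hval : f (γ s) = σ * v (-1) 0 2 := by simp only [hfdef]; rw [(hhot s hs).2]
    rw [hγν s hs n z, ← hval]
    exact h
  -- the ASSEMBLY
  exact quasiconvexOn_ridgeCoeff_of_peakless hpk hcont hσ e ha hr hsrc hP hlat0 hmid0 hκ₀ hC₃0 hC₂0 hthin hκ hαA hexp

end Summit.NavierStokesRegularity.NavierStokesRegularity.Theorems.PoloidalWindowDoorLrcModEntireRidgeClass
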